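import Summits.KontsevichZagierPeriods.KontsevichZagierPeriods.Theorems.RootDecompRelativeModAbsoluteCircleSplitP04

/-! # `RootDecompRelativeModAbsoluteCircleSplitP05` — part 5/12 of the mechanical ≤400-line split of `csk_min.lean` (sha256 066c56c743abe73e…)
Source: decomp-kz lens-3 g14 CircleSplitK.lean @3d3b9378 (= CircleSplit @d1112051 §0–§25 + §26 kernel split + §27 odd→log; critic CLEARED g6-21 l.1371, g7-2 l.1388) minus the 65 declarations already landed in …CircleLogP1–P11 / …CylLogSplitP46–P49 and minus the 20 superseded g13-glue/tame-class lemmas not on the §26–§27 chain; imports …CylLogSplitP48 + …CircleLogP11; --supports stmt-KontsevichZagierPeriods-30572.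
Split by census-1 g10 `gen/splitlean.py`: scopes re-opened with their `open`/`variable`/`set_option` context; mathematics and declaration order unchanged. -/

noncomputable section
open Set MeasureTheory Filter Topology
open scoped BigOperators
open Literature.NumberTheory.Transcendental Literature.ModelTheory.ExponentialFields
namespace Summit.KontsevichZagierPeriods.RootDecompRelativeModAbsolute.Rung30571.RegularisedLogLayer.CylLog.Leaf
namespace G13
variable {b : ℕ}

/-- **(R1ᶜ) with two log families** (the second one on bands `[1, w_j]`) and one arctangent family — a reindexing
(`Fin.append`) of `r1C_of_circleBoundaryRigidity`. -/
theorem r1C₂_of_circleBoundaryRigidity {b : ℕ} (hCBR : CircleBoundaryRigidityAt b)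
    {k l : ℕ} {G : Set (Fin b → ℝ)} (hGo : IsOpen G) (hG : IsSemialgebraic ℚ G)
    (h W : Fin k → (Fin b → ℝ) → ℝ) (hh : ∀ i, IsSemialgebraicFunOn ℚ G (h i))
    (hW : ∀ i, IsSemialgebraicFunOn ℚ G (W i)) (hWd : ∀ i, DifferentiableOn ℝ (W i) G)
    (σ : Fin k → Bool) (hσt : ∀ i, σ i = true → ∀ x ∈ G, 1 ≤ W i x)
    (hσf : ∀ i, σ i = false → ∀ x ∈ G, 0 < W i x ∧ W i x ≤ 1)
    (g w : Fin l → (Fin b → ℝ) → ℝ) (hg : ∀ j, IsSemialgebraicFunOn ℚ G (g j))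
    (hw : ∀ j, IsSemialgebraicFunOn ℚ G (w j)) (hwd : ∀ j, DifferentiableOn ℝ (w j) G)
    (hw1 : ∀ j, ∀ x ∈ G, 1 ≤ w j x)
    (p u : Fin l → (Fin b → ℝ) → ℝ) (hp : ∀ j, IsSemialgebraicFunOn ℚ G (p j))
    (hu : ∀ j, IsSemialgebraicFunOn ℚ G (u j)) (hu0 : ∀ j, ∀ x ∈ G, 0 ≤ u j x)
    (hint : ∀ i, IntegrableOn (fun x => h i x * Real.log (W i x)) G)
    (hintg : ∀ j, IntegrableOn (fun x => g j x * Real.log (w j x)) G)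
    (hintA : ∀ j, IntegrableOn (fun x => p j x * Real.arctan (u j x)) G)
    (hsum : ∀ x ∈ G, ∑ i, h i x * Real.log (W i x) + ∑ j, g j x * Real.log (w j x) +
      ∑ j, p j x * Real.arctan (u j x) = 0)
    (U : Fin k → KZ.IntegralRep (b + 1))
    (hUd : ∀ i, (U i).domain =
      if σ i then KZlog.band G (fun _ => 1) (W i) else KZlog.band G (W i) (fun _ => 1))
    (hUi : ∀ i, EqOn (U i).integrand (fun z => h i (Fin.init z) / z (Fin.last b)) (U i).domain)
    (L : Fin l → KZ.IntegralRep (b + 1)) (hLd : ∀ j, (L j).domain = KZlog.band G (fun _ => 1) (w j))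
    (hLi : ∀ j, EqOn (L j).integrand (fun z => g j (Fin.init z) / z (Fin.last b)) (L j).domain)
    (A : Fin l → KZ.IntegralRep (b + 1)) (hAd : ∀ j, (A j).domain = KZlog.band G (fun _ => 0) (u j))
    (hAi : ∀ j, EqOn (A j).integrand (fun z => p j (Fin.init z) / (1 + z (Fin.last b) ^ 2)) (A j).domain) :
    ∑ i, (if σ i then (1:ℤ) else -1) • KZ.of (U i) + ∑ j, KZ.of (L j) + ∑ j, KZ.of (A j) ∈
      KZ.relations := by
  have hr := r1C_of_circleBoundaryRigidity hCBR (k := k + l) hGo hG (Fin.append h g) (Fin.append W w)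
    (fun i => by
      induction i using Fin.addCases with
      | left i => simp only [Fin.append_left]; exact hh i
      | right j => simp only [Fin.append_right]; exact hg j)
    (fun i => by
      induction i using Fin.addCases with
      | left i => simp only [Fin.append_left]; exact hW i
      | right j => simp only [Fin.append_right]; exact hw j)
    (fun i => by
      induction i using Fin.addCases with
      | left i => simp only [Fin.append_left]; exact hWd i
      | right j => simp only [Fin.append_right]; exact hwd j)
    (Fin.append σ (fun _ => true))
    (fun i => by
      induction i using Fin.addCases with
      | left i => simp only [Fin.append_left]; exact hσt i
      | right j => simp only [Fin.append_right]; exact fun _ => hw1 j)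
    (fun i => by
      induction i using Fin.addCases with
      | left i => simp only [Fin.append_left]; exact hσf i
      | right j => simp only [Fin.append_right]; exact fun h => absurd h (by simp))
    p u hp hu hu0
    (fun i => by
      induction i using Fin.addCases with
      | left i => simp only [Fin.append_left]; exact hint i
      | right j => simp only [Fin.append_right]; exact hintg j)
    hintA
    (fun x hx => by
      rw [Fin.sum_univ_add]
      simp only [Fin.append_left, Fin.append_right]
      exact hsum x hx)
    (Fin.append U L)
    (fun i => by
      induction i using Fin.addCases with
      | left i => simp only [Fin.append_left]; exact hUd i
      | right j => simp only [Fin.append_right, if_true]; exact hLd j)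
    (fun i => by
      induction i using Fin.addCases with
      | left i => simp only [Fin.append_left]; exact hUi i
      | right j => simp only [Fin.append_right]; exact hLi j)
    A (fun j => by rw [hAd j]; rfl) hAi
  rw [Fin.sum_univ_add] at hr
  simpa only [Fin.append_left, Fin.append_right, if_true, one_smul] using hr

/-! ### §7b THE MIXED TAME CLASS CLOSES (`tameCloseC`, twin of g11 `tameClose`): a σ-oriented log family of
regularised cells AND a family of honest circle cells `Q_j = [band_j [0,u_j], p_j t^{2N_j+r_j}/(1+t²)]` with the mixed
LOG–ARCTAN IDENTITY and the TAMENESS bounds satisfy `Σ ε_i[P_i] + Σ [Q_j] − [G, Σ d_i polyLog + Σ p_j circPoly] ∈ KZ.relations`. -/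

/-- For `0 < W ≤ 1`: `|d (W−1)^{j+1}| ≤ ‖d log W‖` (token-identical copy of `RungClosure.lean` v9 §3af, landing as
`…CylLogSplitP27`). -/
private theorem integrableOn_mul_pow_of_log {b : ℕ} {G : Set (Fin b → ℝ)} (hG : IsSemialgebraic ℚ G)
    {d W : (Fin b → ℝ) → ℝ} (hd : IsSemialgebraicFunOn ℚ G d) (hW : IsSemialgebraicFunOn ℚ G W)
    (hW0 : ∀ x ∈ G, 0 < W x) (hW1 : ∀ x ∈ G, W x ≤ 1)
    (hlog : IntegrableOn (fun x => d x * Real.log (W x)) G) (j : ℕ) :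
    IntegrableOn (fun x => d x * (W x - 1) ^ (j + 1)) G := by
  have hGm : MeasurableSet G := hG.measurableSet_holds
  have hsa : IsSemialgebraicFunOn ℚ G (fun x => d x * (W x - 1) ^ (j + 1)) :=
    IsSemialgebraicFunOn.mul_holds hd (isSemialgebraicFunOn_pow' hG
      ((IsSemialgebraicFunOn.sub_holds hW (isSemialgebraicFunOn_ratCast hG 1)).congr fun x _ => by simp) (j + 1))
  refine Integrable.mono' hlog.norm (KZ.aestronglyMeasurable_of_isSemialgebraicFunOn hsa hGm) ?_
  refine (ae_restrict_iff' hGm).mpr (Filter.Eventually.of_forall fun x hx => ?_)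
  have h0 := hW0 x hx
  have h1 := hW1 x hx
  have habs : |W x - 1| ≤ 1 := by rw [abs_sub_comm, abs_of_nonneg (by linarith)]; linarith
  have hle : |W x - 1| ≤ |Real.log (W x)| := by
    rw [abs_sub_comm, abs_of_nonneg (by linarith), abs_of_nonpos (Real.log_nonpos h0.le h1)]
    linarith [Real.log_le_sub_one_of_pos h0]
  rw [norm_mul, norm_mul, Real.norm_eq_abs, Real.norm_eq_abs, Real.norm_eq_abs, abs_pow]
  refine mul_le_mul_of_nonneg_left ?_ (abs_nonneg _)
  calc |W x - 1| ^ (j + 1) ≤ |W x - 1| := pow_le_of_le_one (abs_nonneg _) habs (Nat.succ_ne_zero j)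
    _ ≤ |Real.log (W x)| := hle

/-- The rational part of the circle telescope: `circPoly r N u = Σ_{n<N} −(−1)^N(−1)^n · u^{2n+r+1}/(2n+r+1)`. -/
def circPoly (r N : ℕ) (u : ℝ) : ℝ :=
  ∑ n ∈ Finset.range N, -((-1:ℝ) ^ N * (-1) ^ n) * (u ^ (2 * n + r + 1) / (((2 * n + r : ℕ) : ℝ) + 1))

end G13
end Summit.KontsevichZagierPeriods.RootDecompRelativeModAbsolute.Rung30571.RegularisedLogLayer.CylLog.Leaf
end
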